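/-
Copyright (c) 2026 the pub-hodgecm-mathlib formalisation cell (harness21).  Prover seat hodgecm-mathlib-A-p03 (g24); LEAD F0P3a-plan (g9) WORD T8-41 «(F4)–(F8) PEN 1»,
architect A-p06 (g26) MAP v3 a5916cc7 §2, 2026-09-01.
-/
import Literature.NumberTheory.Rogawski1990.UnitOrbitalIntegralInertClosedForms
import HarnessLib

/-!
# Flicker's unit orbital integrals for `U(3)` at an inert place — THE PRINTED PIECEWISE TABLES (Canad. J. Math. 50 (1998), Cor. 9, Props. 10, 12, 13)

Topic `NumberTheory/Rogawski1990` (road «D-N7-inert», MAP v3 (F4)–(F8)); namespace `Literature.NumberTheory.Rogawski1990.Flicker1998`.  DEFINITIONS ONLY (computable `def`s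
transcribing the printed piecewise values and the finite sums of Cor. 9; no theorem, no instance, no notation, no named fact, no `sorry`).  The SUMMATION IDENTITIES
«Cor. 9 + Prop. 10 ⇒ Prop. 11 = ★ `phiOne`», «Prop. 13 + Prop. 12 ⇒ Prop. 14 = ★ `phiZero`» are the sequels `UnitOrbitalIntegralInertSumsThetaOne∕Zero` (kernel lane);
the VOLUME statements (that `iTen`∕`iThirteen` below ARE the normalised volumes `∫_{P_H∕P_H ∩ H^K_m} 1_{H^K_m}(p⁻¹ (r_θ^j)⁻¹ t_θ r_θ^j p) dp` of Props. 10∕13) are LAYER B of the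
census `F0/P3a/A-p03/g24/CENSUS-F4-F8-FlickerCongruenceVolumes.A-p03g24.md` (7d3fb72a) and are NOT asserted here.

NOTATION [Flicker1998UnitaryFL, §4 p. 85]: `t₀ = diag(a,b,c)`, `a′ = a∕b − 1 ∈ π^{N₁}R_E^×`, `c′ = c∕b − 1 ∈ π^{N₂}R_E^×`, `a′ − c′ ∈ π^N R_E^×`, `a′ + c′ ∈ π^{N₊} R_E^×`,
`M = max(N₁, N₂)`; for the term indexed by `j` (Cor. 9), `ν := N − j`.  In the elliptic situation either `N₊ = N₁ = N₂ < N` or `N ≤ N₊` (p. 85).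
* `corNineWeight q j` = the weight `δ(j = 0) + (1 + q⁻¹) q^j δ(j ≥ 1)` of Cor. 9 (p. 85) (= `[R_E^× : R_E(j)^×]`, Prop. 7);
* `iTen q ν N₊ m` = Prop. 10 (p. 85), `j ≥ 1`: the integral `∫_{P_H∕P_H∩H^K_m} 1_{H^K_m}(…)` = `1` (`m = 0`), `(1 − q⁻²) q^{4m}` (`1 ≤ m ≤ min([ν∕2],[N₊∕2])`),
  `(1 + q⁻¹) q^{ν+2m}` (`ν = N₊ < 2m ≤ 2ν`), `0` otherwise;
* `iThirteen q N N₊ M m` = Prop. 13 (p. 91), `j = 0` (`θ̄ = 0`): `1` (`m = 0`); (a) `(1 − q⁻²) q^{4m}` (`1 ≤ m ≤ min([N∕2],[N₊∕2])`); and, WHEN `N ≤ N₊` (Flicker's «(thus `N ≤ N₊`)»):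
  (b) `(1+q⁻¹) q^{2m+2[N∕2]}` (`[N∕2]+1 ≤ m ≤ min(N,[M∕2])`), (c) `(1+q⁻¹)² q^{2m+N}` (`[M∕2]+1 ≤ m ≤ N`, `M − N` even), (d) `(1+q⁻¹) q^{2m+2[N∕2]}` (`N+1 ≤ m ≤ [M∕2]`),
  (e) `(1+q⁻¹)² q^{2m+N}` (`max(N+1,[M∕2]+1) ≤ m ≤ [(M+N)∕2]`, `M − N` even); `0` otherwise;
* `innerSumTen q ν N₊ = Σ_{m ≤ ν} iTen`, `innerSumThirteen q N N₊ M = Σ_{m ≤ M+N} iThirteen` (all non-zero terms lie in these ranges);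
* `sumThetaOne q N N₊ = Σ_{j odd ≤ N} corNineWeight j · innerSumTen (N − j)` (Cor. 9 for `θ̄ = 1`, written over `ν = N − j ∈ [0, N)`, `N − ν` odd);
  `sumThetaZeroJ q N N₊ = Σ_{j even, 2 ≤ j ≤ N} …` (the `j > 0` part for `θ̄ = 0`, Prop. 12); `sumThetaZero q N N₊ M = innerSumThirteen + sumThetaZeroJ` (Cor. 9 for `θ̄ = 0`).
The cell's exact-arithmetic certificate `F0/P3a/A-p03/g24/flicker_tables.A-p03g24.py` (07557992) checks `sumThetaOne = phiOne`, `sumThetaZero = phiZero`, Prop. 12 and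
THM 15 on 336 admissible parameter sets for `q ∈ {3,5,7,9}` (0 failures; one decoding point fixed by it: Prop. 13 (b)–(e) only under `N ≤ N₊`).
HONEST LABEL: HC_CM is proved only modulo the printed citations until rung 0 closes; this file asserts nothing.

## References
* [Flicker1998UnitaryFL] Y. Z. Flicker, *Elementary proof of the fundamental lemma for a unitary group*, Canad. J. Math. 50 (1998), 74–98: Prop. 7 p. 84, Cor. 9 p. 85, Prop. 10 p. 85,
  Prop. 12 p. 90, Prop. 13 p. 91.
* [Rogawski1990] J. D. Rogawski, *Automorphic Representations of Unitary Groups in Three Variables* (1990), §4.9 Prop. 4.9.1 (b) p. 55.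
-/

namespace Literature.NumberTheory.Rogawski1990.Flicker1998

/-- Cor. 9's weight `δ(j = 0) + (1 + q⁻¹) q^j δ(j ≥ 1)` (= the index `[R_E^× : R_E(j)^×]` of Prop. 7). [cite: Flicker1998UnitaryFL, Cor. 9 p. 85; Prop. 7 p. 84] -/
def corNineWeight (q j : ℕ) : ℚ := if j = 0 then 1 else (1 + ((q : ℚ))⁻¹) * (q : ℚ) ^ j

/-- Prop. 10's value of `∫_{P_H∕P_H∩H^K_m} 1_{H^K_m}(p⁻¹ (r_θ^j)⁻¹ t_θ r_θ^j p) dp` for `j ≥ 1`, `ν = N − j`, as printed. [cite: Flicker1998UnitaryFL, Prop. 10 p. 85] -/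
def iTen (q ν Np m : ℕ) : ℚ :=
  if m = 0 then 1
  else if m ≤ min (ν / 2) (Np / 2) then (1 - ((q : ℚ) ^ 2)⁻¹) * (q : ℚ) ^ (4 * m)
  else if ν = Np ∧ ν < 2 * m ∧ m ≤ ν then (1 + ((q : ℚ))⁻¹) * (q : ℚ) ^ (ν + 2 * m)
  else 0

/-- Prop. 13's value of the same integral for `j = 0` (`θ̄ = 0`), cases (a)–(e) as printed, (b)–(e) under `N ≤ N₊`. [cite: Flicker1998UnitaryFL, Prop. 13 p. 91] -/
def iThirteen (q N Np M m : ℕ) : ℚ :=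
  if m = 0 then 1
  else if m ≤ min (N / 2) (Np / 2) then (1 - ((q : ℚ) ^ 2)⁻¹) * (q : ℚ) ^ (4 * m)
  else if N ≤ Np ∧ N / 2 + 1 ≤ m ∧ m ≤ min N (M / 2) then (1 + ((q : ℚ))⁻¹) * (q : ℚ) ^ (2 * m + 2 * (N / 2))
  else if N ≤ Np ∧ M / 2 + 1 ≤ m ∧ m ≤ N ∧ (M - N) % 2 = 0 then (1 + ((q : ℚ))⁻¹) ^ 2 * (q : ℚ) ^ (2 * m + N)
  else if N ≤ Np ∧ N + 1 ≤ m ∧ m ≤ M / 2 then (1 + ((q : ℚ))⁻¹) * (q : ℚ) ^ (2 * m + 2 * (N / 2))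
  else if N ≤ Np ∧ max (N + 1) (M / 2 + 1) ≤ m ∧ m ≤ (M + N) / 2 ∧ (M - N) % 2 = 0 then (1 + ((q : ℚ))⁻¹) ^ 2 * (q : ℚ) ^ (2 * m + N)
  else 0

/-- `Σ_{m ≥ 0}` of Prop. 10's values (the non-zero ones have `m ≤ ν`). [cite: Flicker1998UnitaryFL, Prop. 10 p. 85] -/
def innerSumTen (q ν Np : ℕ) : ℚ := (Finset.range (ν + 1)).sum fun m => iTen q ν Np m

/-- `Σ_{m ≥ 0}` of Prop. 13's values (the non-zero ones have `m ≤ M + N`). [cite: Flicker1998UnitaryFL, Prop. 13 p. 91] -/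
def innerSumThirteen (q N Np M : ℕ) : ℚ := (Finset.range (M + N + 1)).sum fun m => iThirteen q N Np M m

/-- Cor. 9 for `θ̄ = 1`: `Σ_{j odd ≤ N} w(j) Σ_m I(j,m)`, written over `ν = N − j` (`0 ≤ ν < N`, `N − ν` odd). [cite: Flicker1998UnitaryFL, Cor. 9 p. 85] -/
def sumThetaOne (q N Np : ℕ) : ℚ :=
  (Finset.range N).sum fun ν => if (N - ν) % 2 = 1 then corNineWeight q (N - ν) * innerSumTen q ν Np else 0

/-- The `j > 0` part of Cor. 9 for `θ̄ = 0` (`j` even, `2 ≤ j ≤ N`; `ν = N − j`), = Prop. 12's contribution. [cite: Flicker1998UnitaryFL, Cor. 9 p. 85; Prop. 12 p. 90] -/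
def sumThetaZeroJ (q N Np : ℕ) : ℚ :=
  (Finset.range N).sum fun ν => if (N - ν) % 2 = 0 then corNineWeight q (N - ν) * innerSumTen q ν Np else 0

/-- Cor. 9 for `θ̄ = 0`: the `j = 0` term (Prop. 13) plus the `j > 0` part (Prop. 12). [cite: Flicker1998UnitaryFL, Cor. 9 p. 85] -/
def sumThetaZero (q N Np M : ℕ) : ℚ := innerSumThirteen q N Np M + sumThetaZeroJ q N Np

end Literature.NumberTheory.Rogawski1990.Flicker1998
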